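import Literature.MathematicalPhysics.QuantumFieldTheory.Balaban1983to89.B5Prop12Chain
import Literature.MathematicalPhysics.QuantumFieldTheory.Balaban1983to89.B5FromB4NN

/-!
# B5 Proposition 1.2 from [2] = B4 — the cell's B4 → B5 chain (`B5Ineq113` → `B5Ineq110Gp` → `B5Transfer133` →
# `B5Transfer132` → `B5Prop12Chain`) RE-COMPOSED with B4's Theorem consumed on `0 ≤ α < 1` only (`B5FromB4NN.ThmDepPrintedNN`)

statement-level skeleton of published theorems with citation tags; proofs where landed; nothing here is a claim about the
Yang–Mills mass gap

B5 = T. Bałaban, *Propagators and renormalization transformations for lattice gauge theories. I*, Commun. Math. Phys. **95**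
(1984) 17–40 [cite: Balaban1984PropagatorsI]; [2] = B4 = T. Bałaban, *Regularity and decay of lattice Green's functions*, Commun.
Math. Phys. **89** (1983) 571–597 [cite: Balaban1983RegularityDecay].  Cell `lit-balaban` (Phase-2 proof seat p38 gen 4), file F4b
of the programme «[2]'s Theorem on the torus at A = 0» (HOME `ROWS-B5.md`, row B5.Prop1.2, census item (i) `hThm`; owner r02).

## WHY THIS FILE EXISTS

The five wrappers of the chain take `hThm : B5FromB4.ThmDepPrinted fam₄` (B4's Theorem p. 573, printed dependence, `∀ α < 1`
WITHOUT floor) and pass it down unchanged to the edge `B5FromB4.firstOrderGp_of_B4`, which uses it at `α = 0` and at the given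
`0 ≤ α < 1` only ((1.111) is printed «for 0 ≤ α < 1», p. 35).  The floor-less typing is false for `α < 0` on families with
unbounded volumes, so the concrete torus family (`B4ThmZeroTorusEta.torusEtaFam`, for which `thmDepPrintedNN_torusEtaFam` is
kernel-checked) delivers the FLOORED hypothesis `B5FromB4NN.ThmDepPrintedNN`.  This file re-composes the five wrappers over the
floored edge `B5FromB4NN.firstOrderGp_of_B4NN` / `prop12G0_of_B4NN`: **same statements, binder for binder, with `hThm :
ThmDepPrintedNN fam₄`**, same one-line compositions (`h137_of_display136'`, `residualGpFirst_of_display135`,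
`transfer_of_display133`, `prop12_via132_of_printed_steps`, `local114_noKernel`, `local114_of_realisation`).  Since
`B5FromB4NN.thmDepPrintedNN_of_dep : ThmDepPrinted fam₄ → ThmDepPrintedNN fam₄`, each original wrapper is a case of its `NN` twin.

## WHAT IS PRINTED

B5 p. 39 [PDF 23]: «The operators G′_k were investigated in paper [2] … In paper [2] we have proved all the necessary properties
of G′, except the second order inequalities. … We will prove (1.115)–(1.117), and in fact the whole Proposition 1.2, for the
operator G₀.»; p. 35 [PDF 19], (1.111): «… for 0 ≤ α < 1».

## HONEST SCOPE

Pure re-composition: no new mathematics, no new hypothesis shapes except the floor `0 ≤ α` inside `hThm`.  The hypotheses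
standing for printed mathematics not formalised are exactly those of the originals (`hThm`, `h24`, `h11G0`, `h114G0`/`real₀`,
`h11`, `S1'`/`real`, `hleaf`), with `hThm` now dischargeable on the torus by `B4ThmZeroTorusEta.thmDepPrintedNN_torusEtaFam`
once the remaining located leaves (dictionaries `Dι`, `DictGp`, `Dict137`, …, the two walk `Realisation`s) are supplied for a
torus `B5.Setting` family — not done here.
-/

namespace Literature.MathematicalPhysics.QuantumFieldTheory.Balaban1983to89

namespace B5Prop12ChainNN

open Finset B5FromB4 B5FromB4NN B5Transfer133 B5Transfer132 B5Ineq137 B5Ineq113 B5Ineq110Gp B5Local114 B5Prop12Chain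

noncomputable section

/-- `B5Ineq113.prop12G0_of_B4_via137_113` — S3 of Prop. 1.2 from [2] with `h137` and `h113` discharged — with B4's
Theorem consumed on `0 ≤ α < 1` only (`hThm : ThmDepPrintedNN fam₄`); the composition is the original one over
`B5FromB4NN.prop12G0_of_B4NN`. [cite: Balaban1984PropagatorsI, pp.39–40, (1.111) p.35 («for 0 ≤ α < 1»)] -/
theorem prop12G0_of_B4_via137_113NN {I I₄ I₂₄ : Type} (fam₄ : I₄ → B4.EtaSetting)
    (fam₂₄ : I₂₄ → B4.ScaleSetting) (famGp famG0 : I → B5.Setting) (F : ∀ i, B5FromB4.GpHolder (famGp i))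
    (c : ℝ) (ι : I → ℝ → I₄)
    (Dι : ∀ (i : I) (e : ℝ), 0 < e → B5FromB4.Dict (fam₄ (ι i e)) (famGp i) (F i) c e)
    (SgGp : ∀ i, B5FromB4.ModelSigns (famGp i)) (SgG0 : ∀ i, B5FromB4.ModelSigns (famG0 i))
    (hThm : ThmDepPrintedNN fam₄) (h24 : B4.Lemma24Printed fam₂₄)
    (hRes : B5FromB4.ResidualGpFirst famGp F)
    (Dfam : ∀ i, ScaleData (famGp i)) (L : ℝ) (d : ℕ) (cc ā s₀ : ℝ) (hL : 1 < L) (hs₀ : 0 ≤ s₀)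
    (ha : ∀ i j, |(Dfam i).a j| ≤ ā)
    (h136 : ∀ i, Display136 (Dfam i) L d) (Z : ∀ i, RowZero (Dfam i))
    (D24 : ∀ i, Dict24 fam₂₄ (Dfam i) L s₀) (D236 : ∀ i, Dict236 fam₂₄ (Dfam i) L)
    (Dc : ∀ i, Dict137 (Dfam i) d) (Dc' : ∀ i, Dict113 (Dfam i) d)
    (G : ∀ i, Geometry (Dfam i) L cc) (G' : ∀ i, Geometry113 (Dfam i) L)
    (hRow : ∀ κ : ℝ, 0 < κ → ∃ R Λ : ℝ, ∀ i, RowSums (Dfam i) L d κ R Λ)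
    (N : ∀ i, NormFacts (Dfam i))
    (h11G0 : B5.Prop11Printed famG0)
    (h114G0 : B5.Prop11Printed famG0 → B5.Local114Fam famG0)
    (transfer : B5FromB4.FirstOrderFam famGp → B5FromB4.SecondOrderFam famGp → B5.Local114Fam famG0 →
      B5FromB4.FirstOrderFam famG0 ∧ B5FromB4.SecondOrderFam famG0) :
    B5.Prop12Printed famG0 :=
  prop12G0_of_B4NN fam₄ fam₂₄ famGp famG0 F c ι Dι SgGp SgG0 hThm h24 hRes
    (h137_of_display136' fam₂₄ famGp Dfam L d cc ā s₀ hL hs₀ ha h136 Z D24 D236 Dc Dc' G G' hRow N SgGp)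
    h11G0 h114G0 transfer

/-- `B5Ineq110Gp.prop12G0_of_B4_via135` — S3 with `hRes` discharged as well from (1.135) — with B4's Theorem consumed on
`0 ≤ α < 1` only (`hThm : ThmDepPrintedNN fam₄`). [cite: Balaban1984PropagatorsI, pp.39–40, (1.111) p.35] -/
theorem prop12G0_of_B4_via135NN {I I₄ I₂₄ : Type} (fam₄ : I₄ → B4.EtaSetting)
    (fam₂₄ : I₂₄ → B4.ScaleSetting) (famGp famG0 : I → B5.Setting) (F : ∀ i, B5FromB4.GpHolder (famGp i))
    (c : ℝ) (ι : I → ℝ → I₄)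
    (Dι : ∀ (i : I) (e : ℝ), 0 < e → B5FromB4.Dict (fam₄ (ι i e)) (famGp i) (F i) c e)
    (SgGp : ∀ i, B5FromB4.ModelSigns (famGp i)) (SgG0 : ∀ i, B5FromB4.ModelSigns (famG0 i))
    (hThm : ThmDepPrintedNN fam₄) (h24 : B4.Lemma24Printed fam₂₄)
    (Dfam : ∀ i, ScaleData (famGp i)) (Pfam : ∀ i, GpData (Dfam i)) (L : ℝ) (d : ℕ)
    (cc cb ā aK s₀ pL : ℝ) (hL : 1 < L) (hs₀ : 0 ≤ s₀) (hpL : 0 ≤ pL) (haK : 0 ≤ aK)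
    (ha : ∀ i j, |(Dfam i).a j| ≤ ā)
    (h136 : ∀ i, Display136 (Dfam i) L d) (Z : ∀ i, RowZero (Dfam i))
    (h135R : ∀ i, Display135 (dataR (Dfam i) (Pfam i)) L d 1)
    (h135Z : ∀ i, Display135 (dataZ (Dfam i) (Pfam i)) L d 2)
    (D24 : ∀ i, Dict24 fam₂₄ (Dfam i) L s₀) (D236 : ∀ i, Dict236 fam₂₄ (Dfam i) L)
    (D24G : ∀ i, Dict24Gp fam₂₄ (Dfam i) (Pfam i) L s₀ pL)
    (Lap : ∀ i, LaplaceLeaf (Dfam i) (Pfam i) aK cb)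
    (Dc : ∀ i, Dict137 (Dfam i) d) (Dc' : ∀ i, Dict113 (Dfam i) d)
    (DG : ∀ i, DictGp (Dfam i) (Pfam i) (F i) d)
    (G : ∀ i, Geometry (Dfam i) L cc) (G' : ∀ i, Geometry113 (Dfam i) L)
    (hRow : ∀ κ : ℝ, 0 < κ → ∃ R Λ : ℝ, ∀ i, RowSums (Dfam i) L d κ R Λ)
    (N : ∀ i, NormFacts (Dfam i))
    (h11G0 : B5.Prop11Printed famG0)
    (h114G0 : B5.Prop11Printed famG0 → B5.Local114Fam famG0)
    (transfer : B5FromB4.FirstOrderFam famGp → B5FromB4.SecondOrderFam famGp → B5.Local114Fam famG0 →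
      B5FromB4.FirstOrderFam famG0 ∧ B5FromB4.SecondOrderFam famG0) :
    B5.Prop12Printed famG0 :=
  prop12G0_of_B4_via137_113NN fam₄ fam₂₄ famGp famG0 F c ι Dι SgGp SgG0 hThm h24
    (residualGpFirst_of_display135 fam₂₄ famGp F Dfam Pfam L d cc cb ā aK s₀ pL hL hs₀ hpL haK ha h135R
      h135Z D24G Lap Dc DG G G' hRow N SgGp h24)
    Dfam L d cc ā s₀ hL hs₀ ha h136 Z D24 D236 Dc Dc' G G' hRow N h11G0 h114G0 transfer

/-- `B5Transfer133.prop12G0_of_B4_via133` — Prop. 1.2 for G₀ from [2] with `transfer` discharged by the (1.133) display —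
with B4's Theorem consumed on `0 ≤ α < 1` only (`hThm : ThmDepPrintedNN fam₄`). [cite: Balaban1984PropagatorsI, pp.39–40,
(1.111) p.35] -/
theorem prop12G0_of_B4_via133NN {I I₄ I₂₄ : Type} (fam₄ : I₄ → B4.EtaSetting)
    (fam₂₄ : I₂₄ → B4.ScaleSetting) (famGp famG0 : I → B5.Setting) (F : ∀ i, B5FromB4.GpHolder (famGp i))
    (c : ℝ) (ι : I → ℝ → I₄)
    (Dι : ∀ (i : I) (e : ℝ), 0 < e → B5FromB4.Dict (fam₄ (ι i e)) (famGp i) (F i) c e)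
    (SgGp : ∀ i, B5FromB4.ModelSigns (famGp i)) (SgG0 : ∀ i, B5FromB4.ModelSigns (famG0 i))
    (hThm : ThmDepPrintedNN fam₄) (h24 : B4.Lemma24Printed fam₂₄)
    (Dfam : ∀ i, ScaleData (famGp i)) (Pfam : ∀ i, GpData (Dfam i)) (L : ℝ) (d : ℕ)
    (cc cb ā aK s₀ pL : ℝ) (hL : 1 < L) (hs₀ : 0 ≤ s₀) (hpL : 0 ≤ pL) (haK : 0 ≤ aK)
    (ha : ∀ i j, |(Dfam i).a j| ≤ ā)
    (h136 : ∀ i, Display136 (Dfam i) L d) (Z : ∀ i, RowZero (Dfam i))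
    (h135R : ∀ i, Display135 (dataR (Dfam i) (Pfam i)) L d 1)
    (h135Z : ∀ i, Display135 (dataZ (Dfam i) (Pfam i)) L d 2)
    (D24 : ∀ i, Dict24 fam₂₄ (Dfam i) L s₀) (D236 : ∀ i, Dict236 fam₂₄ (Dfam i) L)
    (D24G : ∀ i, Dict24Gp fam₂₄ (Dfam i) (Pfam i) L s₀ pL)
    (Lap : ∀ i, LaplaceLeaf (Dfam i) (Pfam i) aK cb)
    (Dc : ∀ i, Dict137 (Dfam i) d) (Dc' : ∀ i, Dict113 (Dfam i) d)
    (DG : ∀ i, DictGp (Dfam i) (Pfam i) (F i) d)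
    (G : ∀ i, Geometry (Dfam i) L cc) (G' : ∀ i, Geometry113 (Dfam i) L)
    (hRow : ∀ κ : ℝ, 0 < κ → ∃ R Λ : ℝ, ∀ i, RowSums (Dfam i) L d κ R Λ)
    (N : ∀ i, NormFacts (Dfam i))
    (h11G0 : B5.Prop11Printed famG0)
    (h114G0 : B5.Prop11Printed famG0 → B5.Local114Fam famG0)
    (Kf : ∀ i, Carrier133 (famGp i) (famG0 i)) {A B r0 Nn Dh : ℝ}
    (Fk : ∀ i, CarrierFacts (Kf i) A B r0 Nn) (Dp : ∀ i, Display133 (Kf i) Dh)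
    (hRowU : ∀ κ : ℝ, 0 < κ → ∃ Λ : ℝ, ∀ i, URow (Kf i) κ Λ) :
    B5.Prop12Printed famG0 :=
  prop12G0_of_B4_via135NN fam₄ fam₂₄ famGp famG0 F c ι Dι SgGp SgG0 hThm h24 Dfam Pfam L d cc cb ā aK s₀ pL hL
    hs₀ hpL haK ha h136 Z h135R h135Z D24 D236 D24G Lap Dc Dc' DG G G' hRow N h11G0 h114G0
    (transfer_of_display133 famGp famG0 Kf Fk Dp SgGp SgG0 hRowU)

/-- `B5Transfer132.prop12_of_B4_via132` — the whole B4 → B5 chain for Prop. 1.2 ((1.110)–(1.114)) for G = G(Ω) through the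
(1.132) transfer — with B4's Theorem consumed on `0 ≤ α < 1` only (`hThm : ThmDepPrintedNN fam₄`).  The hypotheses standing
for printed mathematics not formalised are, as there: `hThm`, `h24`, `h11G0`, `h114G0`, `h11`, `S1'`, `hleaf`.
[cite: Balaban1984PropagatorsI, pp.36–40, (1.111) p.35] -/
theorem prop12_of_B4_via132NN {I I₄ I₂₄ : Type} (fam₄ : I₄ → B4.EtaSetting)
    (fam₂₄ : I₂₄ → B4.ScaleSetting) (fam famGp famG0 : I → B5.Setting) (Kd : I → B5.KernelData)
    (F : ∀ i, B5FromB4.GpHolder (famGp i)) (c : ℝ) (ι : I → ℝ → I₄)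
    (Dι : ∀ (i : I) (e : ℝ), 0 < e → B5FromB4.Dict (fam₄ (ι i e)) (famGp i) (F i) c e)
    (SgGp : ∀ i, B5FromB4.ModelSigns (famGp i)) (SgG0 : ∀ i, B5FromB4.ModelSigns (famG0 i))
    (SgG : ∀ i, B5FromB4.ModelSigns (fam i))
    (hThm : ThmDepPrintedNN fam₄) (h24 : B4.Lemma24Printed fam₂₄)
    (Dfam : ∀ i, ScaleData (famGp i)) (Pfam : ∀ i, GpData (Dfam i)) (L : ℝ) (d : ℕ)
    (cc cb ā aK s₀ pL : ℝ) (hL : 1 < L) (hs₀ : 0 ≤ s₀) (hpL : 0 ≤ pL) (haK : 0 ≤ aK)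
    (ha : ∀ i j, |(Dfam i).a j| ≤ ā)
    (h136 : ∀ i, Display136 (Dfam i) L d) (Z : ∀ i, RowZero (Dfam i))
    (h135R : ∀ i, Display135 (dataR (Dfam i) (Pfam i)) L d 1)
    (h135Z : ∀ i, Display135 (dataZ (Dfam i) (Pfam i)) L d 2)
    (D24 : ∀ i, Dict24 fam₂₄ (Dfam i) L s₀) (D236 : ∀ i, Dict236 fam₂₄ (Dfam i) L)
    (D24G : ∀ i, Dict24Gp fam₂₄ (Dfam i) (Pfam i) L s₀ pL)
    (Lap : ∀ i, LaplaceLeaf (Dfam i) (Pfam i) aK cb)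
    (Dc : ∀ i, Dict137 (Dfam i) d) (Dc' : ∀ i, Dict113 (Dfam i) d)
    (DG : ∀ i, DictGp (Dfam i) (Pfam i) (F i) d)
    (G : ∀ i, Geometry (Dfam i) L cc) (G' : ∀ i, Geometry113 (Dfam i) L)
    (hRow : ∀ κ : ℝ, 0 < κ → ∃ R Λ : ℝ, ∀ i, RowSums (Dfam i) L d κ R Λ)
    (N : ∀ i, NormFacts (Dfam i))
    (h11G0 : B5.Prop11Printed famG0)
    (h114G0 : B5.Prop11Printed famG0 → B5.Local114Fam famG0)
    (Kf : ∀ i, Carrier133 (famGp i) (famG0 i)) {A B r0 Nn Dh : ℝ}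
    (Fk : ∀ i, CarrierFacts (Kf i) A B r0 Nn) (Dp : ∀ i, Display133 (Kf i) Dh)
    (hRowU : ∀ κ : ℝ, 0 < κ → ∃ Λ : ℝ, ∀ i, URow (Kf i) κ Λ)
    (h11 : B5.Prop11Printed fam) (hleaf : B5.Kernel126_127Printed Kd)
    (S1' : B5.Prop11Printed fam → B5.Kernel126_127Printed Kd → B5.Local114Fam fam)
    (Kg : ∀ i, Carrier133 (famG0 i) (fam i)) (Kc : ∀ i, KerCarrier (Kd i) (fam i))
    {A₂ B₂ c₀ r₂ N₂ D₂ : ℝ} (Mg : ∀ i, MapFacts (Kg i) r₂ N₂) (Pg : ∀ i, PieceFacts132 (Kg i) (Kc i) A₂ B₂ c₀)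
    (Dg : ∀ i, Display133 (Kg i) D₂) (hRowG : ∀ κ : ℝ, 0 < κ → ∃ Λ : ℝ, ∀ i, URow (Kg i) κ Λ) :
    B5.Prop12Printed fam :=
  prop12_via132_of_printed_steps fam famG0 Kd h11 hleaf S1'
    (prop12G0_of_B4_via133NN fam₄ fam₂₄ famGp famG0 F c ι Dι SgGp SgG0 hThm h24 Dfam Pfam L d cc cb ā aK s₀ pL
      hL hs₀ hpL haK ha h136 Z h135R h135Z D24 D236 D24G Lap Dc Dc' DG G G' hRow N h11G0 h114G0 Kf Fk Dp hRowU)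
    Kg Kc Mg Pg Dg SgG0 SgG hRowG

/-- **`B5Prop12Chain.prop12_of_B4_walk` — the whole B4 → B5 chain for Proposition 1.2 ((1.110)–(1.114)) for G = G(Ω) with
both L² random-walk slots discharged — WITH B4'S THEOREM CONSUMED ON `0 ≤ α < 1` ONLY** (`hThm : ThmDepPrintedNN fam₄`, the
shape the concrete zero-field torus family delivers: `B4ThmZeroTorusEta.thmDepPrintedNN_torusEtaFam`).  The hypotheses standing
for PRINTED MATHEMATICS NOT FORMALISED are, as there, `hThm`, `h24`, `h11G0`, `h11`, `hleaf`; everything else is a located leaf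
or a sign / model-evident fact.  p. 39: «We will prove (1.115)–(1.117), and in fact the whole Proposition 1.2, for the operator
G₀. This together with the properties (1.126), (1.127) of ∂P∂* and (1.89), or (1.114) for the operator G implies immediately
(1.115)–(1.117), or Proposition 1.2 for G.» [cite: Balaban1984PropagatorsI, pp.36–40, (1.111) p.35 («for 0 ≤ α < 1»)] -/
theorem prop12_of_B4_walkNN {I I₄ I₂₄ : Type} (fam₄ : I₄ → B4.EtaSetting)
    (fam₂₄ : I₂₄ → B4.ScaleSetting) (fam famGp famG0 : I → B5.Setting) (Kd : I → B5.KernelData)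
    (F : ∀ i, B5FromB4.GpHolder (famGp i)) (c : ℝ) (ι : I → ℝ → I₄)
    (Dι : ∀ (i : I) (e : ℝ), 0 < e → B5FromB4.Dict (fam₄ (ι i e)) (famGp i) (F i) c e)
    (SgGp : ∀ i, B5FromB4.ModelSigns (famGp i)) (SgG0 : ∀ i, B5FromB4.ModelSigns (famG0 i))
    (SgG : ∀ i, B5FromB4.ModelSigns (fam i))
    (hThm : ThmDepPrintedNN fam₄) (h24 : B4.Lemma24Printed fam₂₄)
    (Dfam : ∀ i, ScaleData (famGp i)) (Pfam : ∀ i, GpData (Dfam i)) (L : ℝ) (d : ℕ)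
    (cc cb ā aK s₀ pL : ℝ) (hL : 1 < L) (hs₀ : 0 ≤ s₀) (hpL : 0 ≤ pL) (haK : 0 ≤ aK)
    (ha : ∀ i j, |(Dfam i).a j| ≤ ā)
    (h136 : ∀ i, Display136 (Dfam i) L d) (Z : ∀ i, RowZero (Dfam i))
    (h135R : ∀ i, Display135 (dataR (Dfam i) (Pfam i)) L d 1)
    (h135Z : ∀ i, Display135 (dataZ (Dfam i) (Pfam i)) L d 2)
    (D24 : ∀ i, Dict24 fam₂₄ (Dfam i) L s₀) (D236 : ∀ i, Dict236 fam₂₄ (Dfam i) L)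
    (D24G : ∀ i, Dict24Gp fam₂₄ (Dfam i) (Pfam i) L s₀ pL)
    (Lap : ∀ i, LaplaceLeaf (Dfam i) (Pfam i) aK cb)
    (Dc : ∀ i, Dict137 (Dfam i) d) (Dc' : ∀ i, Dict113 (Dfam i) d)
    (DG : ∀ i, DictGp (Dfam i) (Pfam i) (F i) d)
    (G : ∀ i, Geometry (Dfam i) L cc) (G' : ∀ i, Geometry113 (Dfam i) L)
    (hRow : ∀ κ' : ℝ, 0 < κ' → ∃ R Λ : ℝ, ∀ i, RowSums (Dfam i) L d κ' R Λ)
    (N : ∀ i, NormFacts (Dfam i))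
    (h11G0 : B5.Prop11Printed famG0)
    (κ₀ : Consts)
    {V₀ : I → ℕ → Type} [∀ i M, NormedAddCommGroup (V₀ i M)] [∀ i M, InnerProductSpace ℝ (V₀ i M)]
    {X₀ : I → ℕ → Type} [∀ i M, PseudoMetricSpace (X₀ i M)]
    {S₀ : I → ℕ → Type} [∀ i M, Fintype (S₀ i M)]
    (real₀ : ∀ (i : I) (M₀ : ℕ), 1 ≤ M₀ →
      Realisation (famG0 i) zeroKernel M₀ κ₀ (V₀ i M₀) (X₀ i M₀) (S₀ i M₀))
    (Kf : ∀ i, Carrier133 (famGp i) (famG0 i)) {A B r0 Nn Dh : ℝ}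
    (Fk : ∀ i, CarrierFacts (Kf i) A B r0 Nn) (Dp : ∀ i, Display133 (Kf i) Dh)
    (hRowU : ∀ κ' : ℝ, 0 < κ' → ∃ Λ : ℝ, ∀ i, URow (Kf i) κ' Λ)
    (h11 : B5.Prop11Printed fam) (hleaf : B5.Kernel126_127Printed Kd)
    (κ : Consts)
    {V : I → ℕ → Type} [∀ i M, NormedAddCommGroup (V i M)] [∀ i M, InnerProductSpace ℝ (V i M)]
    {X : I → ℕ → Type} [∀ i M, PseudoMetricSpace (X i M)]
    {S : I → ℕ → Type} [∀ i M, Fintype (S i M)]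
    (real : ∀ (i : I) (M₀ : ℕ), 1 ≤ M₀ →
      Realisation (fam i) (Kd i) M₀ κ (V i M₀) (X i M₀) (S i M₀))
    (Kg : ∀ i, Carrier133 (famG0 i) (fam i)) (Kc : ∀ i, KerCarrier (Kd i) (fam i))
    {A₂ B₂ c₀ r₂ N₂ D₂ : ℝ} (Mg : ∀ i, MapFacts (Kg i) r₂ N₂) (Pg : ∀ i, PieceFacts132 (Kg i) (Kc i) A₂ B₂ c₀)
    (Dg : ∀ i, Display133 (Kg i) D₂) (hRowG : ∀ κ' : ℝ, 0 < κ' → ∃ Λ : ℝ, ∀ i, URow (Kg i) κ' Λ) :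
    B5.Prop12Printed fam :=
  prop12_of_B4_via132NN fam₄ fam₂₄ fam famGp famG0 Kd F c ι Dι SgGp SgG0 SgG hThm h24 Dfam Pfam L d cc cb ā
    aK s₀ pL hL hs₀ hpL haK ha h136 Z h135R h135Z D24 D236 D24G Lap Dc Dc' DG G G' hRow N h11G0
    (local114_noKernel famG0 κ₀ real₀) Kf Fk Dp hRowU h11 hleaf (local114_of_realisation fam Kd κ real)
    Kg Kc Mg Pg Dg hRowG

end

end B5Prop12ChainNN

end Literature.MathematicalPhysics.QuantumFieldTheory.Balaban1983to89
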